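import Summits.ResolutionOfSingularities.ResolutionOfSingularities.Theorems.HomologicalConductorNoZenoDim2RegularCentre
import Summits.ResolutionOfSingularities.ResolutionOfSingularities.Theorems.HomologicalConductorNoZenoIffKernel
import Literature.AlgebraicGeometry.Resolution.IntegralClosureEssFiniteType
import Literature.AlgebraicGeometry.Resolution.AffineDomainDimension
import Literature.AlgebraicGeometry.Resolution.RankOneReductionProofs
import HarnessLib

/-!
# Crux `NoZenoR` / `NoZeno` (stmt-ResolutionOfSingularities-19943 / -16483) — every stage `T_(n+1)` is the localisation of a
finitely generated NORMAL affine model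

Route `ResolutionOfSingularities/HomologicalConductor`, W4.4 chain; the ROUTE-BOOKKEEPING half of the Jacobian-floor bridge
(CHAIN v24 (ρ38d)/(ρ38h) g3, `L/res-L0-w44-plan-1/FACT-REQUEST-J.md` §«How W4.4 consumes it»: «`T_m` (`m ≥ 1`) is a localisation
of a f.g. NORMAL `k`-domain with fraction field `K` and tr.deg 3»).  OURS (cell res-hironaka): AI-produced and kernel-checked,
weaker than expert review; nothing here is a statement of the manuscript under review (Hironaka 2017); def-free, fact-free.

* `exists_finset_fractions` — a `k`-subalgebra `T ⊆ K` essentially of finite type over `k` is the ring of fractions `a · t⁻¹`,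
  `a, t ∈ k[σ]`, `t` a unit of `T`, for a finite `σ ⊆ T` (Mathlib `Algebra.essFiniteType_iff`, read in `K`).
* `exists_fg_normal_presentation` — for every stage `T_(n+1)` of the canonical tower (`A` f.g. with `Frac A = K`, `k, A ⊆ O`) there
  is a FINITELY GENERATED `k`-subalgebra `A ≤ B ≤ T_(n+1)` which is INTEGRALLY CLOSED (in `K`, and as a ring:
  `IsIntegrallyClosed ↥B`) and of which `T_(n+1)` is a localisation: every `s ∈ T_(n+1)` is `a · t⁻¹` with `a, t ∈ B`,
  `t⁻¹ ∈ T_(n+1)`.  (`B :=` the integral closure in `K` of `A[σ]`, finitely generated by E. Noether's theorem —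
  Literature `exists_adjoin_eq_integralClosure_adjoin`; `B ≤ T_(n+1)` because the stage is normal,
  `d2rc_isIntegrallyClosed_tower_succ`.)
* `tower_eq_loc_of_fractions` — then `T_(n+1) = loc O B` (the stage IS the centre-localisation of its normal model).
* `ringKrullDim_eq_of_trdeg_eq` — such a `B` has `ringKrullDim ↥B = tr.deg_k K` (Literature
  `exists_ringKrullDim_eq_and_trdeg_eq`, `trdeg_eq_trdeg_of_isFractionRing`).
-/

noncomputable section

-- single-problem summit: the doubled namespace component `ResolutionOfSingularities` is forced
set_option linter.dupNamespace false

namespace Summit.ResolutionOfSingularities.ResolutionOfSingularities.Theorems.NoZeno.StagePresentation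

open Summit.ResolutionOfSingularities.ResolutionOfSingularities.Theses.HomologicalConductor
open Summit.ResolutionOfSingularities.ResolutionOfSingularities.Theorems.NoZeno.Birth
open Literature.AlgebraicGeometry.Resolution

variable {k K : Type} [Field k] [Field K] [Algebra k K]

/-! ## §1 Fractions over finitely many elements -/

/-- A `k`-subalgebra `T ⊆ K` essentially of finite type over `k` consists of the fractions `a · t⁻¹` with `a, t ∈ k[σ]` and
`t` a unit of `T`, for some finite `σ ⊆ T`. [folklore] -/
theorem exists_finset_fractions (T : Subalgebra k K) [hE : Algebra.EssFiniteType k ↥T] :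
    ∃ σ : Finset K, (↑σ : Set K) ⊆ T ∧
      ∀ s ∈ T, ∃ a ∈ Algebra.adjoin k (σ : Set K), ∃ t ∈ Algebra.adjoin k (σ : Set K),
        t ≠ 0 ∧ t⁻¹ ∈ T ∧ s = a * t⁻¹ := by
  classical
  obtain ⟨σ₀, hσ₀⟩ := (Algebra.essFiniteType_iff k ↥T).mp hE
  have himg : (Algebra.adjoin k (σ₀ : Set ↥T)).map T.val =
      Algebra.adjoin k ((σ₀.image fun x : ↥T => (x : K)) : Set K) := by
    rw [AlgHom.map_adjoin, Finset.coe_image]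
    rfl
  have hmemK : ∀ z : ↥T, z ∈ Algebra.adjoin k (σ₀ : Set ↥T) →
      (z : K) ∈ Algebra.adjoin k ((σ₀.image fun x : ↥T => (x : K)) : Set K) := by
    intro z hz
    rw [← himg]
    exact ⟨z, hz, rfl⟩
  refine ⟨σ₀.image fun x : ↥T => (x : K), ?_, ?_⟩
  · intro y hy
    obtain ⟨x, -, rfl⟩ := Finset.mem_image.mp (Finset.mem_coe.mp hy)
    exact x.2
  · intro s hs
    obtain ⟨t, ht, htu, hst⟩ := hσ₀ ⟨s, hs⟩
    have ht0 : (t : K) ≠ 0 := by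
      intro h
      have : t = 0 := Subtype.ext h
      rw [this] at htu
      exact not_isUnit_zero htu
    obtain ⟨u, hu⟩ := htu
    have htinv : (t : K)⁻¹ ∈ T := by
      have hmul : (t : K) * ((↑u⁻¹ : ↥T) : K) = 1 := by
        rw [← hu, ← Subalgebra.coe_mul, Units.mul_inv, Subalgebra.coe_one]
      rw [inv_eq_of_mul_eq_one_right hmul]
      exact (↑u⁻¹ : ↥T).2
    refine ⟨s * t, ?_, t, hmemK t ht, ht0, htinv, ?_⟩
    · have := hmemK _ hst
      rwa [Subalgebra.coe_mul] at this
    · rw [mul_assoc, mul_inv_cancel₀ ht0, mul_one]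

/-! ## §2 The finitely generated normal model under a stage -/

/-- **Every stage `T_(n+1)` is the localisation of a finitely generated NORMAL affine model.**  For `A ⊆ O` finitely generated
with `Frac A = K` (`k ⊆ O`) and every `n`, there is a finitely generated `k`-subalgebra `B` with `A ≤ B ≤ T_(n+1)`,
integrally closed (`IsIntegrallyClosed ↥B`, and every element of `K` integral over `B` lies in `B`), such that every element of
`T_(n+1)` is a fraction `a · t⁻¹` with `a, t ∈ B`, `t ≠ 0` and `t⁻¹ ∈ T_(n+1)` — i.e. `T_(n+1) = B_𝔮` for `𝔮 = 𝔪_(T_(n+1)) ∩ B`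
(`= loc O B`, `tower_succ_eq_loc`).
[cite: Liu2002, Prop. 4.1.27, p. 122] -/
theorem exists_fg_normal_presentation (O : ValuationSubring K) (A : Subalgebra k K)
    (hk : ∀ c : k, algebraMap k K c ∈ O) (hA : A.FG) (hfr : IsFractionRing ↥A K)
    (hAO : A.toSubring ≤ O.toSubring) (n : ℕ) :
    ∃ B : Subalgebra k K, B.FG ∧ A ≤ B ∧ B ≤ tower O A (n + 1) ∧ IsIntegrallyClosed ↥B ∧
      (∀ x : K, IsIntegral ↥B x → x ∈ B) ∧
      ∀ s ∈ tower O A (n + 1), ∃ a ∈ B, ∃ t ∈ B, t ≠ 0 ∧ t⁻¹ ∈ tower O A (n + 1) ∧ s = a * t⁻¹ := by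
  classical
  haveI := hfr
  obtain ⟨hAT, -, hE⟩ := tn_tower_invariant O A hk hA hfr hAO (n + 1)
  haveI := hE
  haveI : IsIntegrallyClosed ↥(tower O A (n + 1)) := d2rc_isIntegrallyClosed_tower_succ O A hk hA hfr hAO n
  haveI : IsFractionRing ↥(tower O A (n + 1)) K := isFractionRing_subalgebra_of_le A _ hAT
  haveI : Algebra.FiniteType k ↥A := A.fg_iff_finiteType.mp hA
  obtain ⟨σ, hσT, hfrac⟩ := exists_finset_fractions (tower O A (n + 1))
  -- E. Noether: the integral closure of `A[σ]` in `K` is `A[t]`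
  obtain ⟨t, hσt, hint, hcl⟩ := exists_adjoin_eq_integralClosure_adjoin (k := k) (A := ↥A) (K := K) σ
  obtain ⟨sA, hsA⟩ := hA
  let B : Subalgebra k K := (Algebra.adjoin ↥A (t : Set K)).restrictScalars k
  have hmemB : ∀ x : K, x ∈ B ↔ x ∈ Algebra.adjoin ↥A (t : Set K) := fun x => Iff.rfl
  -- `B = k[sA ∪ t]` is finitely generated
  have hBeq : B = Algebra.adjoin k ((sA : Set K) ∪ (t : Set K)) := by
    rw [Algebra.adjoin_union_eq_adjoin_adjoin]
    -- `adjoin k sA = A`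
    subst hsA
    rfl
  have hBfg : B.FG := ⟨sA ∪ t, by rw [Finset.coe_union, ← hBeq]⟩
  have hAB : A ≤ B := fun x hx => (hmemB x).mpr (Subalgebra.algebraMap_mem _ (⟨x, hx⟩ : ↥A))
  -- `A[σ] ≤ T`, hence `B ≤ T` by normality of the stage
  let C : Subalgebra k K := (Algebra.adjoin ↥A (σ : Set K)).restrictScalars k
  have hCT : C ≤ tower O A (n + 1) := by
    intro x hx
    have hx' : x ∈ Algebra.adjoin ↥A (σ : Set K) := hx
    -- `adjoin A σ ≤ T` viewing `T` as an `A`-subalgebra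
    let T' : Subalgebra ↥A K :=
      { tower O A (n + 1) with
        algebraMap_mem' := fun a => hAT a.2 }
    have hle : Algebra.adjoin ↥A (σ : Set K) ≤ T' := Algebra.adjoin_le hσT
    exact hle hx'
  have hBT : B ≤ tower O A (n + 1) := by
    intro x hx
    have hxint : IsIntegral ↥(Algebra.adjoin ↥A (σ : Set K)) x := (hint x).mp hx
    -- the inclusion `A[σ] → T`, to move integrality up (map the monic polynomial)
    let g : ↥(Algebra.adjoin ↥A (σ : Set K)) →+* ↥(tower O A (n + 1)) :=
      { toFun := fun c => ⟨(c : K), hCT c.2⟩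
        map_one' := Subtype.ext rfl
        map_mul' := fun _ _ => Subtype.ext rfl
        map_zero' := Subtype.ext rfl
        map_add' := fun _ _ => Subtype.ext rfl }
    obtain ⟨p, hp, hpx⟩ := hxint
    have hcomp : (algebraMap ↥(tower O A (n + 1)) K).comp g =
        algebraMap ↥(Algebra.adjoin ↥A (σ : Set K)) K := RingHom.ext fun _ => rfl
    have hxT : IsIntegral ↥(tower O A (n + 1)) x :=
      ⟨p.map g, hp.map g, by rw [Polynomial.eval₂_map, hcomp]; exact hpx⟩
    obtain ⟨y, hy⟩ := (IsIntegrallyClosed.isIntegral_iff (R := ↥(tower O A (n + 1))) (K := K)).mp hxT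
    rw [← hy]
    exact y.2
  -- integrally closed
  have hBint : ∀ x : K, IsIntegral ↥B x → x ∈ B := fun x hx => hcl x hx
  haveI : IsFractionRing ↥B K := isFractionRing_subalgebra_of_le A B hAB
  have hBic : IsIntegrallyClosed ↥B :=
    (isIntegrallyClosed_iff K).mpr fun {x} hx => ⟨⟨x, hBint x hx⟩, rfl⟩
  -- fractions with denominators in `k[σ] ≤ B`
  have hσB : Algebra.adjoin k (σ : Set K) ≤ B := by
    refine Algebra.adjoin_le fun y hy => (hmemB y).mpr (Algebra.subset_adjoin (hσt hy))
  refine ⟨B, hBfg, hAB, hBT, hBic, hBint, fun s hs => ?_⟩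
  obtain ⟨a, ha, t', ht', ht'0, hinv, hs'⟩ := hfrac s hs
  exact ⟨a, hσB ha, t', hσB ht', ht'0, hinv, hs'⟩

/-- **`T_(n+1) = loc O B`** for the finitely generated normal model `B` of `exists_fg_normal_presentation` — indeed for any
`B ≤ T_(n+1)` over which `T_(n+1)` consists of fractions with `T_(n+1)`-unit denominators (`k, A ⊆ O`). [folklore] -/
theorem tower_eq_loc_of_fractions (O : ValuationSubring K) (A : Subalgebra k K)
    (hk : ∀ c : k, algebraMap k K c ∈ O) (hAO : A.toSubring ≤ O.toSubring) (m : ℕ) (B : Subalgebra k K)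
    (hBT : B ≤ tower O A m)
    (hfrac : ∀ s ∈ tower O A m, ∃ a ∈ B, ∃ t ∈ B, t ≠ 0 ∧ t⁻¹ ∈ tower O A m ∧ s = a * t⁻¹) :
    tower O A m = loc O B := by
  have hTO : ∀ x ∈ tower O A m, x ∈ O := fun x hx => mem_valuationSubring_of_mem_tower O hk hAO m x hx
  apply le_antisymm
  · intro s hs
    obtain ⟨a, ha, t, ht, -, htinv, rfl⟩ := hfrac s hs
    exact Algebra.subset_adjoin ⟨a, ha, t, ht, hTO _ htinv, rfl⟩
  · rw [loc]
    refine Algebra.adjoin_le ?_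
    rintro y ⟨a, ha, t, ht, htO, rfl⟩
    refine Subalgebra.mul_mem _ (hBT ha) ?_
    by_cases ht0 : t = 0
    · rw [ht0, inv_zero]; exact Subalgebra.zero_mem _
    obtain ⟨B', hB'O, hTB'⟩ := exists_tower_eq_loc O A hk hAO m
    have htT : t ∈ tower O A m := hBT ht
    rw [hTB', loc_eq_locAt] at htT ⊢
    exact SyzygyFlattening.inv_mem_locAt O B' hB'O htT
      (SyzygyFlattening.valuation_eq_one_of_inv_mem O (hTO t (hBT ht)) htO ht0)

/-- The finitely generated model has Krull dimension `tr.deg_k K` (when the latter is a natural number `d`).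
[cite: Matsumura1987, Thm. 5.6] -/
theorem ringKrullDim_eq_of_trdeg_eq (A B : Subalgebra k K) (hfr : IsFractionRing ↥A K) (hAB : A ≤ B)
    (hB : B.FG) {d : ℕ} (htr : Algebra.trdeg k K = d) : ringKrullDim ↥B = d := by
  haveI := hfr
  haveI : IsFractionRing ↥B K := isFractionRing_subalgebra_of_le A B hAB
  haveI : Algebra.FiniteType k ↥B := B.fg_iff_finiteType.mp hB
  obtain ⟨n, hn, htrB⟩ := exists_ringKrullDim_eq_and_trdeg_eq k ↥B
  have hnd : (n : Cardinal) = d := by rw [← htrB, ← trdeg_eq_trdeg_of_isFractionRing B, htr]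
  have hnd' : n = d := by exact_mod_cast hnd
  rw [hn, hnd']

end Summit.ResolutionOfSingularities.ResolutionOfSingularities.Theorems.NoZeno.StagePresentation

end
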